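import Literature.NumberTheory.Automorphic.ShimuraCurveCartanLevel
import Literature.NumberTheory.Automorphic.EichlerSubidealCount
import Literature.NumberTheory.Automorphic.QuaternionOrderIntegral
import HarnessLib

/-!
# TRANSPORT behind NUM, brick H1: RESIDUE MODELS `ψ_p : O₀ ↠ M₂(𝔽_p)` of the Eichler hull, with `tr ∘ ψ_p = trd`, `det ∘ ψ_p = nrd`

Helper file `--supports stmt-BirchSwinnertonDyer-19109 --as helper` (seat `bsd-idea-10` g17, lens transfer; crux `EulerHalvesAtThree` ∕ residue crux
23422 line `cartan`, node (F2b♮) ⟺ NUM; road memo `Cruxes/EulerHalvesAtThree/TRANSPORT-HULL.md` §3.4, brick H1 of the general-`C` presentation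
independence `CartanDegreeIndep` by hull transfer; the same residue models are the input of the LEVEL-`q` quotient `O₀'/q O₀' ≅ M₂(𝔽_q)` of the
analytic cover (LEAD tam3-p1 g26, `NUM-LINES-AND-D1-DESIGN-g26.md` §4 (ii), M0)). A residue model is the tree's predicate
`IsMatrixResidueMap O p ψ` (`ψ : B → M₂(F)` additive, multiplicative, unital on `O`, onto, kernel `p O`). THIS FILE (all PROVED):
* §1 `exists_isMatrixResidueMap_of_isMaximalZOrder` — the tree's abstract reduction `exists_modPow_reduction` (`k = 1`, values in `ZMod (p ^ 1)`)
  repackaged with values in `M₂(ZMod p)`;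
* §2 `isMatrixResidueMap_of_le` — RESTRICTION to a suborder of index prime to `p` (Bezout); hence §4 `exists_isMatrixResidueMap_of_isEichlerOrder`
  for an Eichler order of level `N`, `p ∤ N`, at a split prime;
* §3 **`trace_eq_intCast`, `det_eq_intCast`, `trace_det`** — for ANY residue model `ψ` on ANY order `O` and `x ∈ O`: `tr ψ(x) = trd x (mod p)` and
  `det ψ(x) = nrd x (mod p)` (`trd x, nrd x ∈ ℤ` by the tree's `Brandt.IsOrder.exists_int_reducedTrace_reducedNorm`). The tree's reduction maps
  are abstract (no norm clause, cf. the docstring of `Literature…QuaternionLocalSplit`); the clause is recovered from the ring structure alone: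
  Cayley–Hamilton on both sides gives `(trd x − tr ψx)·ψx = (nrd x − det ψx)·1`, which settles non-scalar images; a scalar image is perturbed by a
  `w` with `ψ w = E₀₁` (additivity of the trace), and the norm clause follows from `x (trd x − x) = nrd x`; `det_eq_one_of_reducedNorm_eq_one`
  (norm-one units land in `SL₂(𝔽_p)` — the form brick S consumes);
* §5 for a Cartan datum `X` of level `(D, M; C)`: `nonempty_algEquiv_padic` (`B_p ≅ M₂(ℚ_p)` for `p ∤ D`), **`exists_isMatrixResidueMap_hull`** (a residue
  model of the hull `O₀` at every `p ∤ D M`), `exists_isMatrixResidueMap_of_mem` (in particular at every Cartan prime `q ∈ C`).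
HONEST FRAMING: bookkeeping (one brick of seven); nothing about NUM, crux 23422 ∕ 19109 or any summit statement is proved by this seat; BSD is
proved for no curve. [folklore]
-/

set_option linter.dupNamespace false
set_option autoImplicit false

noncomputable section

open scoped TensorProduct NumberField

namespace Summit.BirchSwinnertonDyer.BirchSwinnertonDyer.Theorems.CartanTransport.Residue

open Literature.NumberTheory.Automorphic

universe u

section General

variable {B : Type u} [Ring B] [Algebra ℚ B] [IsQuaternionAlgebra ℚ B]

/-! ## §1 Residue models of a maximal order with values in `M₂(ZMod p)` -/

/-- PROVED — **residue model of a maximal order at a split prime**, valued in `M₂(ZMod p)` (the tree's `exists_modPow_reduction` with `k = 1`,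
transported along `ZMod (p ^ 1) ≃ ZMod p`). [cite: VignerasLNM800, Ch. II §2 Thm. 2.3 (1) and Ch. III §5 Prop. 5.1] -/
theorem exists_isMatrixResidueMap_of_isMaximalZOrder {O₁ : Submodule ℤ B} (hO₁ : IsMaximalZOrder O₁) {p : ℕ} [Fact p.Prime]
    (hsplit : Nonempty (ℚ_[p] ⊗[ℚ] B ≃ₐ[ℚ_[p]] Matrix (Fin 2) (Fin 2) ℚ_[p])) :
    ∃ ψ : B → Matrix (Fin 2) (Fin 2) (ZMod p), IsMatrixResidueMap O₁ p ψ := by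
  obtain ⟨ψ₁, hadd, hmul, hone, hsurj, hker⟩ := exists_modPow_reduction hO₁ hsplit 1
  let e : Matrix (Fin 2) (Fin 2) (ZMod (p ^ 1)) ≃+* Matrix (Fin 2) (Fin 2) (ZMod p) :=
    (ZMod.ringEquivCongr (pow_one p)).mapMatrix
  refine ⟨fun x => e (ψ₁ x), fun x hx y hy => ?_, fun x hx y hy => ?_, ?_, fun m => ?_, fun x hx => ?_⟩
  · simp only [hadd x hx y hy, map_add]
  · simp only [hmul x hx y hy, map_mul]
  · simp only [hone, map_one]
  · obtain ⟨x, hx, hxm⟩ := hsurj (e.symm m)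
    exact ⟨x, hx, by simp only [hxm, RingEquiv.apply_symm_apply]⟩
  · rw [EmbeddingLike.map_eq_zero_iff, hker x hx, pow_one]

/-! ## §2 Restriction to a suborder of index prime to `p` -/

omit [Algebra ℚ B] [IsQuaternionAlgebra ℚ B] in
/-- PROVED — **RESTRICTION**: a residue model `ψ` of `O₁` modulo `p` is a residue model of every suborder `O ⊆ O₁` with `N·O₁ ⊆ O`, `p ∤ N`
(Bezout `a N + b p = 1`: `x₁ ↦ a N x₁ ∈ O` has the same image, and `p y ∈ O`, `y ∈ O₁` force `y = a(N y) + b(p y) ∈ O`). [folklore] -/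
theorem isMatrixResidueMap_of_le {O O₁ : Submodule ℤ B} {p : ℕ} [Fact p.Prime] {ψ : B → Matrix (Fin 2) (Fin 2) (ZMod p)}
    (h : IsMatrixResidueMap O₁ p ψ) (hle : O ≤ O₁) {N : ℕ} (hN : ∀ x ∈ O₁, (N : ℤ) • x ∈ O) (hpN : p.Coprime N) :
    IsMatrixResidueMap O p ψ := by
  obtain ⟨a, b, hab⟩ : IsCoprime (N : ℤ) (p : ℤ) := Nat.isCoprime_iff_coprime.mpr hpN.symm
  have hcast : ((a * N : ℤ) : ZMod p) = 1 := by
    have h1 : ((a * N + b * p : ℤ) : ZMod p) = 1 := by rw [hab, Int.cast_one]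
    rwa [Int.cast_add, Int.cast_mul b, Int.cast_natCast p, ZMod.natCast_self, mul_zero, add_zero] at h1
  refine ⟨fun x hx y hy => h.map_add x (hle hx) y (hle hy), fun x hx y hy => h.map_mul x (hle hx) y (hle hy), h.map_one,
    fun m => ?_, fun x hx => ⟨fun hx0 => ?_, ?_⟩⟩
  · obtain ⟨x₁, hx₁, hm⟩ := h.surj m
    refine ⟨(a * N : ℤ) • x₁, ?_, ?_⟩
    · rw [← smul_smul]
      exact O.smul_mem a (hN x₁ hx₁)
    · rw [h.map_zsmul hx₁, hm, ← Int.cast_smul_eq_zsmul (ZMod p), hcast, one_smul]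
  · obtain ⟨y, hy, hxy⟩ := (h.ker x (hle hx)).mp hx0
    refine ⟨y, ?_, hxy⟩
    have hy' : y = a • ((N : ℤ) • y) + b • x := by
      rw [hxy, smul_smul, smul_smul, ← add_smul, hab, one_smul]
    rw [hy']
    exact O.add_mem (O.smul_mem a (hN y hy)) (O.smul_mem b hx)
  · rintro ⟨y, hy, rfl⟩
    exact h.map_smul_eq_zero (hle hy)

/-! ## §3 Traces and determinants of residues -/

section TraceDet

variable {O : Submodule ℤ B} {p : ℕ} [Fact p.Prime] {ψ : B → Matrix (Fin 2) (Fin 2) (ZMod p)}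

/-- PROVED: Cayley–Hamilton for `2 × 2` matrices over `𝔽_p`, `X² = tr X · X − det X · 1`. [folklore] -/
theorem mat_mul_self (X : Matrix (Fin 2) (Fin 2) (ZMod p)) : X * X = X.trace • X - X.det • (1 : Matrix (Fin 2) (Fin 2) (ZMod p)) := by
  ext i j
  rw [Matrix.trace_fin_two, Matrix.det_fin_two]
  fin_cases i <;> fin_cases j <;> simp [Matrix.mul_apply, Fin.sum_univ_two] <;> ring

/-- PROVED — **the image of the reduced characteristic polynomial**: for `x ∈ O` with `trd x = t`, `nrd x = n` (`t, n ∈ ℤ`),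
`ψ(x)² = t·ψ(x) − n·1` in `M₂(𝔽_p)` (tree `mul_self_eq_reducedTrace_mul_sub_reducedNorm`: `x² = trd(x) x − nrd(x)` in `B`). [cite: VignerasLNM800, Ch. I §1 Lemme 1.1] -/
theorem map_mul_self (h : IsMatrixResidueMap O p ψ) (hO : Brandt.IsOrder B O) {x : B} (hx : x ∈ O) {t n : ℤ}
    (ht : reducedTrace ℚ B x = t) (hn : reducedNorm ℚ B x = n) :
    ψ x * ψ x = (t : ZMod p) • ψ x - (n : ZMod p) • (1 : Matrix (Fin 2) (Fin 2) (ZMod p)) := by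
  have hB : x * x = t • x - n • (1 : B) := by
    rw [mul_self_eq_reducedTrace_mul_sub_reducedNorm ℚ B x, ht, hn, Algebra.algebraMap_eq_smul_one, Algebra.algebraMap_eq_smul_one,
      smul_mul_assoc, one_mul, Int.cast_smul_eq_zsmul, Int.cast_smul_eq_zsmul]
  have h1 : (1 : B) ∈ O := hO.one_mem
  rw [← h.map_mul x hx x hx, hB, h.map_sub (O.smul_mem t hx) (O.smul_mem n h1), h.map_zsmul hx, h.map_zsmul h1, h.map_one,
    Int.cast_smul_eq_zsmul, Int.cast_smul_eq_zsmul]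

/-- PROVED — **non-scalar images**: if `ψ(x)` is not a scalar matrix then `tr ψ(x) = trd x` and `det ψ(x) = nrd x` modulo `p` (compare the two
Cayley–Hamilton identities: `(trd x − tr ψx)·ψx = (nrd x − det ψx)·1`). [folklore] -/
theorem trace_det_of_not_scalar (h : IsMatrixResidueMap O p ψ) (hO : Brandt.IsOrder B O) {x : B} (hx : x ∈ O) {t n : ℤ}
    (ht : reducedTrace ℚ B x = t) (hn : reducedNorm ℚ B x = n)
    (hns : ¬ ((ψ x) 0 1 = 0 ∧ (ψ x) 1 0 = 0 ∧ (ψ x) 0 0 = (ψ x) 1 1)) :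
    (ψ x).trace = t ∧ (ψ x).det = n := by
  have hE := (map_mul_self h hO hx ht hn).symm.trans (mat_mul_self (ψ x))
  have e : ∀ i j, (t : ZMod p) * ψ x i j - (n : ZMod p) * (1 : Matrix (Fin 2) (Fin 2) (ZMod p)) i j =
      (ψ x).trace * ψ x i j - (ψ x).det * (1 : Matrix (Fin 2) (Fin 2) (ZMod p)) i j := fun i j => by
    simpa only [Matrix.sub_apply, Matrix.smul_apply, smul_eq_mul] using congrFun (congrFun hE i) j
  have e00 := e 0 0
  have e01 := e 0 1
  have e10 := e 1 0
  have e11 := e 1 1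
  simp only [Matrix.one_apply_eq, ne_eq, zero_ne_one, not_false_eq_true, Matrix.one_apply_ne, one_ne_zero, mul_one, mul_zero,
    sub_zero] at e00 e01 e10 e11
  have htr : (ψ x).trace = t := by
    by_contra hne
    have hd : (t : ZMod p) - (ψ x).trace ≠ 0 := sub_ne_zero.mpr (Ne.symm hne)
    apply hns
    refine ⟨?_, ?_, ?_⟩
    · have h01 : ((t : ZMod p) - (ψ x).trace) * ψ x 0 1 = 0 := by linear_combination e01
      exact (mul_eq_zero.mp h01).resolve_left hd
    · have h10 : ((t : ZMod p) - (ψ x).trace) * ψ x 1 0 = 0 := by linear_combination e10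
      exact (mul_eq_zero.mp h10).resolve_left hd
    · have h00 : ((t : ZMod p) - (ψ x).trace) * (ψ x 0 0 - ψ x 1 1) = 0 := by linear_combination e00 - e11
      exact sub_eq_zero.mp ((mul_eq_zero.mp h00).resolve_left hd)
  refine ⟨htr, ?_⟩
  have hdet : (n : ZMod p) = (ψ x).det := by linear_combination -e00 - ψ x 0 0 * htr
  exact hdet.symm

/-- PROVED — **`tr ψ(x) = trd x (mod p)` for every `x ∈ O`** (non-scalar images: `trace_det_of_not_scalar`; a scalar image is perturbed by `w ∈ O` with
`ψ w = E₀₁`, and the trace is additive on both sides). [folklore] -/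
theorem trace_eq_intCast (h : IsMatrixResidueMap O p ψ) (hO : Brandt.IsOrder B O) {x : B} (hx : x ∈ O) {t : ℤ}
    (ht : reducedTrace ℚ B x = t) : (ψ x).trace = t := by
  obtain ⟨t₀, n, ht₀, hn⟩ := hO.exists_int_reducedTrace_reducedNorm hx
  have htt : t₀ = t := by exact_mod_cast ht₀.symm.trans ht
  subst htt
  by_cases hns : ¬ ((ψ x) 0 1 = 0 ∧ (ψ x) 1 0 = 0 ∧ (ψ x) 0 0 = (ψ x) 1 1)
  · exact (trace_det_of_not_scalar h hO hx ht₀ hn hns).1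
  rw [not_not] at hns
  obtain ⟨w, hw, hwE⟩ := h.surj (Matrix.single 0 1 1)
  obtain ⟨t', n', ht', hn'⟩ := hO.exists_int_reducedTrace_reducedNorm hw
  have hxw : x + w ∈ O := O.add_mem hx hw
  have htxw : reducedTrace ℚ B (x + w) = (t₀ + t' : ℤ) := by
    rw [map_add, ht₀, ht']
    push_cast
    ring
  obtain ⟨-, n'', -, hn''⟩ := hO.exists_int_reducedTrace_reducedNorm hxw
  have hns1 : ¬ ((ψ (x + w)) 0 1 = 0 ∧ (ψ (x + w)) 1 0 = 0 ∧ (ψ (x + w)) 0 0 = (ψ (x + w)) 1 1) := by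
    rw [h.map_add x hx w hw, hwE]
    rintro ⟨h01, -, -⟩
    rw [Matrix.add_apply, hns.1, Matrix.single_apply_same, zero_add] at h01
    exact one_ne_zero h01
  have hns2 : ¬ ((ψ w) 0 1 = 0 ∧ (ψ w) 1 0 = 0 ∧ (ψ w) 0 0 = (ψ w) 1 1) := by
    rw [hwE]
    rintro ⟨h01, -, -⟩
    rw [Matrix.single_apply_same] at h01
    exact one_ne_zero h01
  have h1 := (trace_det_of_not_scalar h hO hxw htxw hn'' hns1).1
  have h2 := (trace_det_of_not_scalar h hO hw ht' hn' hns2).1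
  rw [h.map_add x hx w hw, Matrix.trace_add, h2, Int.cast_add] at h1
  exact add_right_cancel h1

/-- PROVED — **`det ψ(x) = nrd x (mod p)` for every `x ∈ O`** (from the trace clause and `x·(trd x − x) = nrd x`: `ψx·(tr ψx·1 − ψx) = det ψx·1`). [folklore] -/
theorem det_eq_intCast (h : IsMatrixResidueMap O p ψ) (hO : Brandt.IsOrder B O) {x : B} (hx : x ∈ O) {n : ℤ}
    (hn : reducedNorm ℚ B x = n) : (ψ x).det = n := by
  obtain ⟨t, n₀, ht, hn₀⟩ := hO.exists_int_reducedTrace_reducedNorm hx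
  have hnn : n₀ = n := by exact_mod_cast hn₀.symm.trans hn
  subst hnn
  have htr := trace_eq_intCast h hO hx ht
  have hE := (map_mul_self h hO hx ht hn₀).symm.trans (mat_mul_self (ψ x))
  rw [htr] at hE
  have e00 : (t : ZMod p) * ψ x 0 0 - (n₀ : ZMod p) * (1 : Matrix (Fin 2) (Fin 2) (ZMod p)) 0 0 =
      (t : ZMod p) * ψ x 0 0 - (ψ x).det * (1 : Matrix (Fin 2) (Fin 2) (ZMod p)) 0 0 := by
    simpa only [Matrix.sub_apply, Matrix.smul_apply, smul_eq_mul] using congrFun (congrFun hE 0) 0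
  rw [Matrix.one_apply_eq, mul_one, mul_one] at e00
  linear_combination e00

/-- PROVED — **THE NORM∕TRACE CLAUSE of a residue model**: for `x ∈ O` there are `t, n ∈ ℤ` with `trd x = t`, `nrd x = n`, `tr ψ(x) = t`,
`det ψ(x) = n`. [folklore] -/
theorem trace_det (h : IsMatrixResidueMap O p ψ) (hO : Brandt.IsOrder B O) {x : B} (hx : x ∈ O) :
    ∃ t n : ℤ, reducedTrace ℚ B x = t ∧ reducedNorm ℚ B x = n ∧ (ψ x).trace = t ∧ (ψ x).det = n := by
  obtain ⟨t, n, ht, hn⟩ := hO.exists_int_reducedTrace_reducedNorm hx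
  exact ⟨t, n, ht, hn, trace_eq_intCast h hO hx ht, det_eq_intCast h hO hx hn⟩

/-- PROVED: the same with rational casts, `tr ψ(x) = (trd x : 𝔽_p)` and `det ψ(x) = (nrd x : 𝔽_p)`. [folklore] -/
theorem trace_det_ratCast (h : IsMatrixResidueMap O p ψ) (hO : Brandt.IsOrder B O) {x : B} (hx : x ∈ O) :
    (ψ x).trace = ((reducedTrace ℚ B x : ℚ) : ZMod p) ∧ (ψ x).det = ((reducedNorm ℚ B x : ℚ) : ZMod p) := by
  obtain ⟨t, n, ht, hn, htr, hdet⟩ := trace_det h hO hx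
  rw [ht, hn, Rat.cast_intCast, Rat.cast_intCast]
  exact ⟨htr, hdet⟩

/-- PROVED — **norm-one elements land in `SL₂(𝔽_p)`**: `nrd x = 1 ⇒ det ψ(x) = 1`. [folklore] -/
theorem det_eq_one_of_reducedNorm_eq_one (h : IsMatrixResidueMap O p ψ) (hO : Brandt.IsOrder B O) {x : B} (hx : x ∈ O)
    (h1 : reducedNorm ℚ B x = 1) : (ψ x).det = 1 := by
  have := det_eq_intCast h hO hx (n := 1) (by rw [h1, Int.cast_one])
  rwa [Int.cast_one] at this

/-- PROVED — **traceless elements**: `trd x = 0 ⇒ tr ψ(x) = 0`. [folklore] -/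
theorem trace_eq_zero_of_reducedTrace_eq_zero (h : IsMatrixResidueMap O p ψ) (hO : Brandt.IsOrder B O) {x : B} (hx : x ∈ O)
    (h0 : reducedTrace ℚ B x = 0) : (ψ x).trace = 0 := by
  have := trace_eq_intCast h hO hx (t := 0) (by rw [h0, Int.cast_zero])
  rwa [Int.cast_zero] at this

end TraceDet

/-! ## §4 Eichler orders -/

/-- PROVED — **residue model of an Eichler order of level `N` at a split prime `p ∤ N`** (the maximal order `O₁ ⊇ O` of the definition has index
`N` prime to `p`; §1 + §2). [cite: VignerasLNM800, Ch. II §2 Thm. 2.3 (1), Ch. III §5 Prop. 5.1] -/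
theorem exists_isMatrixResidueMap_of_isEichlerOrder {O : Submodule ℤ B} {N : ℕ} (hO : Brandt.IsEichlerOrder B O N) {p : ℕ} [Fact p.Prime]
    (hpN : ¬ p ∣ N) (hsplit : Nonempty (ℚ_[p] ⊗[ℚ] B ≃ₐ[ℚ_[p]] Matrix (Fin 2) (Fin 2) ℚ_[p])) :
    ∃ ψ : B → Matrix (Fin 2) (Fin 2) (ZMod p), IsMatrixResidueMap O p ψ := by
  have hp : p.Prime := Fact.out
  haveI : IsAddTorsionFree B := isAddTorsionFree_of_charZero_module ℚ B
  obtain ⟨O₁, O₂, h₁, -, hO12, hidx⟩ := isEichlerOrder_iff_brandt.mpr hO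
  obtain ⟨ψ, hψ⟩ := exists_isMatrixResidueMap_of_isMaximalZOrder h₁ hsplit
  have hle : O ≤ O₁ := hO12 ▸ inf_le_left
  refine ⟨ψ, isMatrixResidueMap_of_le hψ hle (N := N) (fun x hx => ?_) (hp.coprime_iff_not_dvd.mpr hpN)⟩
  rw [← hidx, natCast_zsmul]
  exact AddSubgroup.nsmul_relIndex_mem O.toAddSubgroup (K := O₁.toAddSubgroup) hx

end General

/-! ## §5 Cartan data -/

section Cartan

variable {D M : ℕ} {C : Finset ℕ}

/-- PROVED — **`B_p ≅ M₂(ℚ_p)` at `p ∤ D`** for the algebra of a Cartan datum (it is ramified exactly at the primes dividing `D`; tree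
`nonempty_algEquiv_padic_of_isSplitAt`). [cite: VignerasLNM800, Ch. II §2 and Ch. III §3] -/
theorem nonempty_algEquiv_padic (X : CartanLevelCurveData D M C) {p : ℕ} [Fact p.Prime] (hpD : ¬ p ∣ D) :
    Nonempty (ℚ_[p] ⊗[ℚ] X.B ≃ₐ[ℚ_[p]] Matrix (Fin 2) (Fin 2) ℚ_[p]) := by
  have hp : p.Prime := Fact.out
  set v := (Rat.HeightOneSpectrum.primesEquiv (R := 𝓞 ℚ)).symm ⟨p, hp⟩ with hv
  have hvp : ((Rat.HeightOneSpectrum.primesEquiv v : Nat.Primes) : ℕ) = p := by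
    rw [hv, Equiv.apply_symm_apply]
  refine nonempty_algEquiv_padic_of_isSplitAt X.B v ?_ p hvp
  by_contra hns
  have hmem : v ∈ ramifiedPlaces ℚ X.B := hns
  rw [X.ramifiedPlaces_eq, Set.mem_setOf_eq, hvp] at hmem
  exact hpD hmem

/-- PROVED — **RESIDUE MODEL OF THE HULL**: for a Cartan datum `X` of level `(D, M; C)` and a prime `p ∤ D M` there is `ψ : B → M₂(𝔽_p)` which on the
Eichler hull `O₀` is a surjective ring homomorphism with kernel `p O₀` (and, by §3, `tr ψ = trd`, `det ψ = nrd` modulo `p`). [folklore] -/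
theorem exists_isMatrixResidueMap_hull (X : CartanLevelCurveData D M C) {p : ℕ} [Fact p.Prime] (hp : ¬ p ∣ D * M) :
    ∃ ψ : X.B → Matrix (Fin 2) (Fin 2) (ZMod p), IsMatrixResidueMap X.O₀ p ψ :=
  exists_isMatrixResidueMap_of_isEichlerOrder X.isEichlerOrder (fun h => hp (Dvd.dvd.mul_left h D))
    (nonempty_algEquiv_padic X fun h => hp (Dvd.dvd.mul_right h M))

/-- PROVED — **residue model of the hull at a Cartan prime `q ∈ C`** (`q ∤ D M` by the datum's `coprime`). [folklore] -/
theorem exists_isMatrixResidueMap_of_mem (X : CartanLevelCurveData D M C) {q : ℕ} [Fact q.Prime] (hq : q ∈ C) :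
    ∃ ψ : X.B → Matrix (Fin 2) (Fin 2) (ZMod q), IsMatrixResidueMap X.O₀ q ψ :=
  exists_isMatrixResidueMap_hull X (X.coprime q hq).2

/-- PROVED — residue models of the hull restrict to the Cartan order as ring homomorphisms killing `q O₀ ⊆ O`-multiples: for `x ∈ O`,
`ψ` is additive and multiplicative on `O` (`O ≤ O₀`) and `ψ((∏ C)·y) = 0` for `y ∈ O₀` when `q ∈ C` (as `(∏ C)` is a multiple of `q`). [folklore] -/
theorem map_prod_smul_eq_zero (X : CartanLevelCurveData D M C) {q : ℕ} [Fact q.Prime] (hq : q ∈ C)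
    {ψ : X.B → Matrix (Fin 2) (Fin 2) (ZMod q)} (h : IsMatrixResidueMap X.O₀ q ψ) {y : X.B} (hy : y ∈ X.O₀) :
    ψ (((∏ p ∈ C, p : ℕ) : ℤ) • y) = 0 := by
  obtain ⟨m, hm⟩ : q ∣ ∏ p ∈ C, p := Finset.dvd_prod_of_mem _ hq
  rw [hm, Nat.cast_mul, ← smul_smul, smul_comm, h.map_zsmul (X.O₀.smul_mem _ hy), h.map_smul_eq_zero hy, smul_zero]

end Cartan

end Summit.BirchSwinnertonDyer.BirchSwinnertonDyer.Theorems.CartanTransport.Residue
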